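import Summits.BirchSwinnertonDyer.BirchSwinnertonDyer.Theorems.KimAtThreeSemiLocalTraceDualCyc
import HarnessLib

/-!
# Route `KimAtThreeKolyvagin` (W2), the deep leaf's UNIFORM road (clause X1-int_b / (LAT_b)) at levels
# DIVISIBLE by `p`: `p^{v_p(m)}·(cycIntLattice p m)^∨ ⊆ cycIntLattice p m`, and (LAT_{1+v_p(m)})

Cell `bsd-addord`, seat `bsd-addord-w2-acc3` (PROGRAMME PART 1b row (3), gen 5); third file of the seat's
trace-duality set (`KimAtThreeSemiLocalTraceDual`, `…Cyc`); `--supports stmt-BirchSwinnertonDyer-19679`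
(helper).  TOOL theorems only (no definition, no named fact, no `sorry`); nothing asserted about any curve.

WHY.  (C1ₑₓ)'s compatibility clause is `∃ b, ∀ j r, X1-int_b` over ALL finite level sets `r`
(`KimAtThreeDeepLeafOfDefinedKatoUniform`, seat w2-c3 g7: "`b = 1` at tame `r`, `b = 2` if `(3) ∈ r`").
At a level `m = cycLevel p 0 r` divisible by `p` the lattice `cycIntLattice p m = ℤ_p⟨1 ⊗ ζ_m^j⟩` is no
longer self-dual (`ℚ(ζ_m)` ramifies at `p`), but the companion files' identity `m = ζ·Φ_m′(ζ)·Q(ζ)` holds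
for EVERY `m`, so `m·ℤ[ζ]^∨ ⊆ ℤ[ζ]` and, cancelling the prime-to-`p` part of `m` (a `p`-adic unit),
**`p^{v_p(m)}·(cycIntLattice p m)^∨ ⊆ cycIntLattice p m`** — the exact different bound, with no
discriminant or ramification theory.  Consequently the uniform road's lattice clause holds with
`b = 1 + v_p(m)` at every level (`= 2` when `p ∥ m`), from the same two per-factor inputs as at tame level
(log-lattices `Λ₀ʷ ⊇ p𝒪_w` — true also at the ramified `w`, since `log_ω(Ê(𝔪_w²)) = 𝔪_w² ⊇ p𝒪_w` —
and the `p`-integral duality pairing (S5b) at `K = L_w`).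

* §1 `pow_padicValNat_smul_mem_cycIntLattice_of_norm_trace_mul_zeta_pow_le_one` (any `m`).
* §2 `pow_padicValNat_smul_symm_mem_cycIntLattice_of_forall_trace_mul_mem` (any `m`, along w2-acc4's `Ψ`).
* §3 `pow_padicValNat_succ_smul_symm_mem_cycIntLattice_of_pairing` — (LAT_{1+v_p(m)}), any `m`.
* §4 `sum_symm_single_eq` — the consumers' `Σ_w ι_w(·)` form with `ι_w = Ψ⁻¹ ∘ single_w`;
  `sum_symm_single_mem_of_pairing` — (LAT_b) in acc5's binder shape for ANY target module `M` containing
  every `μ` with `p^{1+v_p(m)}·μ ∈ cycIntLattice p m`.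
* §5 (appended) `pow_add_padicValNat_smul_symm_mem_cycIntLattice_of_pairing` /
  `sum_symm_single_mem_of_pairing_pow` — the same with a general log-lattice exponent `c`
  (`p^c·𝒪_w ⊆ Λ₀ʷ`; `c = 1` at additive reduction, `c = 2` from the tree's reduction-free radius-`1/4`
  surjectivity at `p = 3`), giving `b = c + v_p(m)`.

References: [Kim2022StructureSelmer] §3.4.1 and the proof of Thm. 3.13; [CasselsFrohlichANT1967] II §10–§11;
J. Neukirch, *Algebraic Number Theory*, III (2.4)–(2.9) [folklore].
-/

set_option autoImplicit false
-- the Theorems namespace of a single-conjunct summit repeats the summit name by design (D-0017)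
set_option linter.dupNamespace false
-- `CyclotomicField m ℚ`'s two `ℚ`-algebra structures agree only up to unfolding (as in the sibling files)
set_option backward.isDefEq.respectTransparency false

noncomputable section

open scoped TensorProduct NumberField
open NumberField Polynomial IsDedekindDomain
open Summit.BirchSwinnertonDyer.Rank1Residual.GaloisImage
open Summit.BirchSwinnertonDyer.BirchSwinnertonDyer.Theorems.KimAtThreePortSharedSATCore
open Summit.BirchSwinnertonDyer.BirchSwinnertonDyer.Theorems.KimAtThreeSemiLocalTraceDual
open Summit.BirchSwinnertonDyer.BirchSwinnertonDyer.Theorems.KimAtThreeSemiLocalTraceDualCyc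

namespace Summit.BirchSwinnertonDyer.BirchSwinnertonDyer.Theorems.KimAtThreeSemiLocalTraceDualLevel

variable (m : ℕ) [NeZero m] (p : ℕ) [Fact p.Prime]

/-! ### §1 `p^{v_p(m)}·(cycIntLattice p m)^∨ ⊆ cycIntLattice p m` (any level `m`) -/

/-- The prime-to-`p` part of `m` is a `p`-adic unit, so `p^{v_p(m)}•x ∈ L` as soon as `m•x ∈ L`, for any
`ℤ_p`-submodule `L`. [folklore] -/
theorem pow_padicValNat_smul_mem_of_natCast_smul_mem {A : Type*} [AddCommGroup A] [Module ℚ_[p] A]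
    [Module ℤ_[p] A] [IsScalarTower ℤ_[p] ℚ_[p] A] (L : Submodule ℤ_[p] A) {x : A}
    (hx : (m : ℚ_[p]) • x ∈ L) : ((p ^ padicValNat p m : ℕ) : ℤ_[p]) • x ∈ L := by
  have hp : p.Prime := Fact.out
  have hm0 : m ≠ 0 := NeZero.ne m
  set m' : ℕ := m / p ^ m.factorization p with hm'
  have hdecomp : p ^ padicValNat p m * m' = m := by
    rw [← Nat.factorization_def m hp, hm']
    exact Nat.ordProj_mul_ordCompl_eq_self m p
  have hndvd : ¬ p ∣ m' := Nat.not_dvd_ordCompl hp hm0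
  have hnorm : ‖((m' : ℤ) : ℤ_[p])‖ = 1 := by
    refine le_antisymm (PadicInt.norm_le_one _) (not_lt.mp fun hlt => hndvd ?_)
    have := (PadicInt.norm_int_lt_one_iff_dvd (p := p) (m' : ℤ)).mp hlt
    exact_mod_cast this
  obtain ⟨u, hu⟩ := PadicInt.isUnit_iff.mpr hnorm
  have hmx : (m : ℚ_[p]) • x = (u : ℤ_[p]) • (((p ^ padicValNat p m : ℕ) : ℤ_[p]) • x) := by
    rw [smul_smul, ← IsScalarTower.algebraMap_smul ℚ_[p] ((u : ℤ_[p]) * ((p ^ padicValNat p m : ℕ) : ℤ_[p])) x,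
      hu, map_mul, map_intCast, map_natCast]
    congr 1
    have hcast : (m : ℚ_[p]) = ((p : ℚ_[p]) ^ padicValNat p m) * (m' : ℚ_[p]) := by
      exact_mod_cast hdecomp.symm
    rw [hcast]
    push_cast
    ring
  rw [hmx] at hx
  have := Submodule.smul_mem _ (↑u⁻¹ : ℤ_[p]) hx
  rwa [smul_smul, Units.inv_mul, one_smul] at this

/-- **`p^{v_p(m)}·(cycIntLattice p m)^∨ ⊆ cycIntLattice p m`** for EVERY level `m`: if `a ∈ ℚ_p ⊗ ℚ(ζ_m)`
has `‖Tr(a·(1 ⊗ ζ_m^j))‖ ≤ 1` for all `j`, then `p^{v_p(m)}·a ∈ cycIntLattice p m` (so `b = 1` at tame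
levels, `b = 2` when `p ∥ m`: the different of `ℚ(ζ_m)` at `p`).
[cite: Kim2022StructureSelmer, §3.4.1 and the proof of Thm. 3.13 (arXiv v3 pp. 26–27)] -/
theorem pow_padicValNat_smul_mem_cycIntLattice_of_norm_trace_mul_zeta_pow_le_one
    {a : ℚ_[p] ⊗[ℚ] CyclotomicField m ℚ}
    (ha : ∀ j : ℕ, ‖Algebra.trace ℚ_[p] (ℚ_[p] ⊗[ℚ] CyclotomicField m ℚ)
        (a * ((1 : ℚ_[p]) ⊗ₜ[ℚ] (IsCyclotomicExtension.zeta m ℚ (CyclotomicField m ℚ) ^ j)))‖ ≤ 1) :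
    ((p ^ padicValNat p m : ℕ) : ℤ_[p]) • a ∈ cycIntLattice p m :=
  pow_padicValNat_smul_mem_of_natCast_smul_mem m p _
    (natCast_smul_mem_cycIntLattice_of_norm_trace_mul_zeta_pow_le_one m p ha)

/-! ### §2 Per-factor form along w2-acc4's `Ψ` (any level `m`) -/

/-- **Traces of `Ψ⁻¹ y` against `1 ⊗ ζ^j` are `p`-integral when every `y_w` lies in the trace dual of
`𝒪_w`** (`Tr = Σ_w Tr_w ∘ Ψ`, w2-acc4's `padicTensor_trace`; `Ψ(1 ⊗ ζ^j)_w ∈ 𝒪_w`).  Any `m`.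
[cite: CasselsFrohlichANT1967, Ch. II §10 Theorem (10.2) and §11] -/
theorem norm_trace_symm_mul_one_tmul_zeta_pow_le_one
    [Fintype (((Rat.HeightOneSpectrum.primesEquiv (R := 𝓞 ℚ)).symm ⟨p, Fact.out⟩).Extension
      (𝓞 (CyclotomicField m ℚ)))]
    (Ψ : ℚ_[p] ⊗[ℚ] CyclotomicField m ℚ ≃ₐ[ℚ]
      (Π w : ((Rat.HeightOneSpectrum.primesEquiv (R := 𝓞 ℚ)).symm ⟨p, Fact.out⟩).Extension
        (𝓞 (CyclotomicField m ℚ)), w.1.adicCompletion (CyclotomicField m ℚ)))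
    (hΨ : ∀ (s : ℚ_[p]) (x : CyclotomicField m ℚ)
      (w : ((Rat.HeightOneSpectrum.primesEquiv (R := 𝓞 ℚ)).symm ⟨p, Fact.out⟩).Extension
        (𝓞 (CyclotomicField m ℚ))),
      Ψ (s ⊗ₜ[ℚ] x) w = algebraMap (CyclotomicField m ℚ) (w.1.adicCompletion (CyclotomicField m ℚ)) x *
        algebraMap (((Rat.HeightOneSpectrum.primesEquiv (R := 𝓞 ℚ)).symm ⟨p, Fact.out⟩).adicCompletion ℚ)
          (w.1.adicCompletion (CyclotomicField m ℚ)) (Padic.adicCompletionEquiv (𝓞 ℚ) ⟨p, Fact.out⟩ s))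
    (y : Π w : ((Rat.HeightOneSpectrum.primesEquiv (R := 𝓞 ℚ)).symm ⟨p, Fact.out⟩).Extension
        (𝓞 (CyclotomicField m ℚ)), w.1.adicCompletion (CyclotomicField m ℚ))
    (hy : ∀ w, ∀ o ∈ w.1.adicCompletionIntegers (CyclotomicField m ℚ),
      Algebra.trace (((Rat.HeightOneSpectrum.primesEquiv (R := 𝓞 ℚ)).symm ⟨p, Fact.out⟩).adicCompletion ℚ)
          (w.1.adicCompletion (CyclotomicField m ℚ)) (y w * o) ∈
        (((Rat.HeightOneSpectrum.primesEquiv (R := 𝓞 ℚ)).symm ⟨p, Fact.out⟩).adicCompletionIntegers ℚ))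
    (j : ℕ) :
    ‖Algebra.trace ℚ_[p] (ℚ_[p] ⊗[ℚ] CyclotomicField m ℚ)
        (Ψ.symm y * ((1 : ℚ_[p]) ⊗ₜ[ℚ] (IsCyclotomicExtension.zeta m ℚ (CyclotomicField m ℚ) ^ j)))‖ ≤ 1 := by
  have hint : IsIntegral ℤ (IsCyclotomicExtension.zeta m ℚ (CyclotomicField m ℚ) ^ j) :=
    ((IsCyclotomicExtension.zeta_spec m ℚ (CyclotomicField m ℚ)).isIntegral (NeZero.pos m)).pow j
  set b : 𝓞 (CyclotomicField m ℚ) := ⟨_, (mem_integralClosure_iff ℤ (CyclotomicField m ℚ)).mpr hint⟩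
    with hb
  have hbz : (b : CyclotomicField m ℚ) = IsCyclotomicExtension.zeta m ℚ (CyclotomicField m ℚ) ^ j := rfl
  rw [← hbz]
  set t := Algebra.trace ℚ_[p] (ℚ_[p] ⊗[ℚ] CyclotomicField m ℚ)
    (Ψ.symm y * ((1 : ℚ_[p]) ⊗ₜ[ℚ] (b : CyclotomicField m ℚ))) with ht
  have het : Padic.adicCompletionEquiv (𝓞 ℚ) ⟨p, Fact.out⟩ t ∈
      (((Rat.HeightOneSpectrum.primesEquiv (R := 𝓞 ℚ)).symm ⟨p, Fact.out⟩).adicCompletionIntegers ℚ) := by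
    rw [ht, Literature.NumberTheory.AdelicBaseChange.padicTensor_trace Ψ hΨ, map_mul,
      AlgEquiv.apply_symm_apply]
    refine Subring.sum_mem _ fun w _ => ?_
    rw [Pi.mul_apply]
    refine hy w _ ?_
    have h := Literature.NumberTheory.AdelicBaseChange.padicTensor_tmul_mem_adicCompletionIntegers
      (Ψ : ℚ_[p] ⊗[ℚ] CyclotomicField m ℚ →ₐ[ℚ] _) hΨ 1 b w
    rwa [PadicInt.coe_one] at h
  have hts : t = ((PadicInt.adicCompletionIntegersEquiv (𝓞 ℚ) ⟨p, Fact.out⟩).symm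
      ⟨_, het⟩ : ℤ_[p]) := by
    rw [PadicInt.coe_adicCompletionIntegersEquiv_symm_apply]
    exact ((Padic.adicCompletionEquiv (𝓞 ℚ) ⟨p, Fact.out⟩).symm_apply_apply t).symm
  rw [hts]
  exact PadicInt.norm_le_one _

/-- **Per-factor duals, any level `m`**: `p^{v_p(m)}·Ψ⁻¹ y ∈ cycIntLattice p m` whenever every `y_w`
lies in the trace dual of `𝒪_w`. [cite: CasselsFrohlichANT1967, Ch. II §10 Theorem (10.2) and §11] -/
theorem pow_padicValNat_smul_symm_mem_cycIntLattice_of_forall_trace_mul_mem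
    [Fintype (((Rat.HeightOneSpectrum.primesEquiv (R := 𝓞 ℚ)).symm ⟨p, Fact.out⟩).Extension
      (𝓞 (CyclotomicField m ℚ)))]
    (Ψ : ℚ_[p] ⊗[ℚ] CyclotomicField m ℚ ≃ₐ[ℚ]
      (Π w : ((Rat.HeightOneSpectrum.primesEquiv (R := 𝓞 ℚ)).symm ⟨p, Fact.out⟩).Extension
        (𝓞 (CyclotomicField m ℚ)), w.1.adicCompletion (CyclotomicField m ℚ)))
    (hΨ : ∀ (s : ℚ_[p]) (x : CyclotomicField m ℚ)
      (w : ((Rat.HeightOneSpectrum.primesEquiv (R := 𝓞 ℚ)).symm ⟨p, Fact.out⟩).Extension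
        (𝓞 (CyclotomicField m ℚ))),
      Ψ (s ⊗ₜ[ℚ] x) w = algebraMap (CyclotomicField m ℚ) (w.1.adicCompletion (CyclotomicField m ℚ)) x *
        algebraMap (((Rat.HeightOneSpectrum.primesEquiv (R := 𝓞 ℚ)).symm ⟨p, Fact.out⟩).adicCompletion ℚ)
          (w.1.adicCompletion (CyclotomicField m ℚ)) (Padic.adicCompletionEquiv (𝓞 ℚ) ⟨p, Fact.out⟩ s))
    (y : Π w : ((Rat.HeightOneSpectrum.primesEquiv (R := 𝓞 ℚ)).symm ⟨p, Fact.out⟩).Extension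
        (𝓞 (CyclotomicField m ℚ)), w.1.adicCompletion (CyclotomicField m ℚ))
    (hy : ∀ w, ∀ o ∈ w.1.adicCompletionIntegers (CyclotomicField m ℚ),
      Algebra.trace (((Rat.HeightOneSpectrum.primesEquiv (R := 𝓞 ℚ)).symm ⟨p, Fact.out⟩).adicCompletion ℚ)
          (w.1.adicCompletion (CyclotomicField m ℚ)) (y w * o) ∈
        (((Rat.HeightOneSpectrum.primesEquiv (R := 𝓞 ℚ)).symm ⟨p, Fact.out⟩).adicCompletionIntegers ℚ)) :
    ((p ^ padicValNat p m : ℕ) : ℤ_[p]) • Ψ.symm y ∈ cycIntLattice p m :=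
  pow_padicValNat_smul_mem_cycIntLattice_of_norm_trace_mul_zeta_pow_le_one m p
    (norm_trace_symm_mul_one_tmul_zeta_pow_le_one m p Ψ hΨ y hy)

/-! ### §3 (LAT_{1+v_p(m)}) — the uniform road's lattice clause at any level -/

/-- **(LAT_{1+v_p(m)}) from per-factor duality data, ANY level `m`**: per-factor sets `Λ₀ʷ ⊇ p·𝒪_w` and
maps `φ_w : H_w → L_w` pairing `p`-integrally with `Λ₀ʷ` under `Tr_{L_w/ℚ_v}` give
`p^{1+v_p(m)}·Ψ⁻¹((φ_w(z_w))_w) ∈ cycIntLattice p m` for every family `z` (tame `m`: the companion's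
`prime_smul_symm_mem_cycIntLattice_of_pairing`, `b = 1`; `p ∥ m`: `b = 2`).
[cite: Kim2022StructureSelmer, §3.4.1 and the proof of Thm. 3.13 (arXiv v3 pp. 26–27)]
[cite: BlochKato1990, Prop. 3.8] -/
theorem pow_padicValNat_succ_smul_symm_mem_cycIntLattice_of_pairing
    [Fintype (((Rat.HeightOneSpectrum.primesEquiv (R := 𝓞 ℚ)).symm ⟨p, Fact.out⟩).Extension
      (𝓞 (CyclotomicField m ℚ)))]
    (Ψ : ℚ_[p] ⊗[ℚ] CyclotomicField m ℚ ≃ₐ[ℚ]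
      (Π w : ((Rat.HeightOneSpectrum.primesEquiv (R := 𝓞 ℚ)).symm ⟨p, Fact.out⟩).Extension
        (𝓞 (CyclotomicField m ℚ)), w.1.adicCompletion (CyclotomicField m ℚ)))
    (hΨ : ∀ (s : ℚ_[p]) (x : CyclotomicField m ℚ)
      (w : ((Rat.HeightOneSpectrum.primesEquiv (R := 𝓞 ℚ)).symm ⟨p, Fact.out⟩).Extension
        (𝓞 (CyclotomicField m ℚ))),
      Ψ (s ⊗ₜ[ℚ] x) w = algebraMap (CyclotomicField m ℚ) (w.1.adicCompletion (CyclotomicField m ℚ)) x *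
        algebraMap (((Rat.HeightOneSpectrum.primesEquiv (R := 𝓞 ℚ)).symm ⟨p, Fact.out⟩).adicCompletion ℚ)
          (w.1.adicCompletion (CyclotomicField m ℚ)) (Padic.adicCompletionEquiv (𝓞 ℚ) ⟨p, Fact.out⟩ s))
    {H : ((Rat.HeightOneSpectrum.primesEquiv (R := 𝓞 ℚ)).symm ⟨p, Fact.out⟩).Extension
        (𝓞 (CyclotomicField m ℚ)) → Type*}
    (φ : ∀ w, H w → w.1.adicCompletion (CyclotomicField m ℚ))
    (Λ₀ : ∀ w : ((Rat.HeightOneSpectrum.primesEquiv (R := 𝓞 ℚ)).symm ⟨p, Fact.out⟩).Extension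
        (𝓞 (CyclotomicField m ℚ)), Set (w.1.adicCompletion (CyclotomicField m ℚ)))
    (hΛ₀ : ∀ w, ∀ o ∈ w.1.adicCompletionIntegers (CyclotomicField m ℚ),
      (p : w.1.adicCompletion (CyclotomicField m ℚ)) * o ∈ Λ₀ w)
    (hpair : ∀ w (x : H w), ∀ l ∈ Λ₀ w,
      Algebra.trace (((Rat.HeightOneSpectrum.primesEquiv (R := 𝓞 ℚ)).symm ⟨p, Fact.out⟩).adicCompletion ℚ)
          (w.1.adicCompletion (CyclotomicField m ℚ)) (φ w x * l) ∈
        (((Rat.HeightOneSpectrum.primesEquiv (R := 𝓞 ℚ)).symm ⟨p, Fact.out⟩).adicCompletionIntegers ℚ))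
    (z : ∀ w, H w) :
    ((p ^ (padicValNat p m + 1) : ℕ) : ℤ_[p]) • Ψ.symm (fun w => φ w (z w)) ∈ cycIntLattice p m := by
  have hsmul : ((p : ℕ) : ℤ_[p]) • Ψ.symm (fun w => φ w (z w)) =
      Ψ.symm (fun w => (p : w.1.adicCompletion (CyclotomicField m ℚ)) * φ w (z w)) := by
    rw [Nat.cast_smul_eq_nsmul, ← map_nsmul]
    congr 1
    funext w
    rw [Pi.smul_apply, nsmul_eq_mul]
  rw [pow_succ, Nat.cast_mul, mul_smul, hsmul]
  refine pow_padicValNat_smul_symm_mem_cycIntLattice_of_forall_trace_mul_mem m p Ψ hΨ _ fun w o ho => ?_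
  rw [mul_comm (p : w.1.adicCompletion (CyclotomicField m ℚ)), mul_assoc]
  exact hpair w (z w) _ (hΛ₀ w o ho)

/-! ### §4 The consumers' `Σ_w ι_w` shape (acc5's (LAT) binder) -/

omit [NeZero m] in
/-- `Σ_w Ψ⁻¹(single_w(y_w)) = Ψ⁻¹ y` — the consumers' `ι_w := Ψ⁻¹ ∘ single_w`. [folklore] -/
theorem sum_symm_single_eq
    [Fintype (((Rat.HeightOneSpectrum.primesEquiv (R := 𝓞 ℚ)).symm ⟨p, Fact.out⟩).Extension
      (𝓞 (CyclotomicField m ℚ)))]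
    [DecidableEq (((Rat.HeightOneSpectrum.primesEquiv (R := 𝓞 ℚ)).symm ⟨p, Fact.out⟩).Extension
      (𝓞 (CyclotomicField m ℚ)))]
    (Ψ : ℚ_[p] ⊗[ℚ] CyclotomicField m ℚ ≃ₐ[ℚ]
      (Π w : ((Rat.HeightOneSpectrum.primesEquiv (R := 𝓞 ℚ)).symm ⟨p, Fact.out⟩).Extension
        (𝓞 (CyclotomicField m ℚ)), w.1.adicCompletion (CyclotomicField m ℚ)))
    (y : Π w : ((Rat.HeightOneSpectrum.primesEquiv (R := 𝓞 ℚ)).symm ⟨p, Fact.out⟩).Extension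
        (𝓞 (CyclotomicField m ℚ)), w.1.adicCompletion (CyclotomicField m ℚ)) :
    ∑ w, Ψ.symm (Pi.single w (y w)) = Ψ.symm y := by
  rw [← map_sum, Finset.univ_sum_single]

/-- **(LAT_b) in acc5's binder shape** (`∀ z, Σ_w ι_w(φ_w(z_w)) ∈ M` of
`KimAtThreeFineKatoLevelCompat.compat_of_semiLocalDef`, with `ι_w = Ψ⁻¹ ∘ single_w`, `V_w = L_w`), for ANY
target `ℤ_p`-submodule `M` containing every `μ` with `p^{1+v_p(m)}·μ ∈ cycIntLattice p m` (e.g.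
`M_b = {μ : p^b·μ ∈ cycIntLattice}`, `b = 1 + v_p(m)`), from the per-factor duality data of §3.
[cite: Kim2022StructureSelmer, §3.4.1 and the proof of Thm. 3.13 (arXiv v3 pp. 26–27)] -/
theorem sum_symm_single_mem_of_pairing
    [Fintype (((Rat.HeightOneSpectrum.primesEquiv (R := 𝓞 ℚ)).symm ⟨p, Fact.out⟩).Extension
      (𝓞 (CyclotomicField m ℚ)))]
    [DecidableEq (((Rat.HeightOneSpectrum.primesEquiv (R := 𝓞 ℚ)).symm ⟨p, Fact.out⟩).Extension
      (𝓞 (CyclotomicField m ℚ)))]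
    (Ψ : ℚ_[p] ⊗[ℚ] CyclotomicField m ℚ ≃ₐ[ℚ]
      (Π w : ((Rat.HeightOneSpectrum.primesEquiv (R := 𝓞 ℚ)).symm ⟨p, Fact.out⟩).Extension
        (𝓞 (CyclotomicField m ℚ)), w.1.adicCompletion (CyclotomicField m ℚ)))
    (hΨ : ∀ (s : ℚ_[p]) (x : CyclotomicField m ℚ)
      (w : ((Rat.HeightOneSpectrum.primesEquiv (R := 𝓞 ℚ)).symm ⟨p, Fact.out⟩).Extension
        (𝓞 (CyclotomicField m ℚ))),
      Ψ (s ⊗ₜ[ℚ] x) w = algebraMap (CyclotomicField m ℚ) (w.1.adicCompletion (CyclotomicField m ℚ)) x *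
        algebraMap (((Rat.HeightOneSpectrum.primesEquiv (R := 𝓞 ℚ)).symm ⟨p, Fact.out⟩).adicCompletion ℚ)
          (w.1.adicCompletion (CyclotomicField m ℚ)) (Padic.adicCompletionEquiv (𝓞 ℚ) ⟨p, Fact.out⟩ s))
    (M : Submodule ℤ_[p] (ℚ_[p] ⊗[ℚ] CyclotomicField m ℚ))
    (hM : ∀ μ : ℚ_[p] ⊗[ℚ] CyclotomicField m ℚ,
      ((p ^ (padicValNat p m + 1) : ℕ) : ℤ_[p]) • μ ∈ cycIntLattice p m → μ ∈ M)
    {H : ((Rat.HeightOneSpectrum.primesEquiv (R := 𝓞 ℚ)).symm ⟨p, Fact.out⟩).Extension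
        (𝓞 (CyclotomicField m ℚ)) → Type*}
    (φ : ∀ w, H w → w.1.adicCompletion (CyclotomicField m ℚ))
    (Λ₀ : ∀ w : ((Rat.HeightOneSpectrum.primesEquiv (R := 𝓞 ℚ)).symm ⟨p, Fact.out⟩).Extension
        (𝓞 (CyclotomicField m ℚ)), Set (w.1.adicCompletion (CyclotomicField m ℚ)))
    (hΛ₀ : ∀ w, ∀ o ∈ w.1.adicCompletionIntegers (CyclotomicField m ℚ),
      (p : w.1.adicCompletion (CyclotomicField m ℚ)) * o ∈ Λ₀ w)
    (hpair : ∀ w (x : H w), ∀ l ∈ Λ₀ w,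
      Algebra.trace (((Rat.HeightOneSpectrum.primesEquiv (R := 𝓞 ℚ)).symm ⟨p, Fact.out⟩).adicCompletion ℚ)
          (w.1.adicCompletion (CyclotomicField m ℚ)) (φ w x * l) ∈
        (((Rat.HeightOneSpectrum.primesEquiv (R := 𝓞 ℚ)).symm ⟨p, Fact.out⟩).adicCompletionIntegers ℚ))
    (z : ∀ w, H w) :
    ∑ w, Ψ.symm (Pi.single w (φ w (z w))) ∈ M := by
  rw [sum_symm_single_eq m p Ψ]
  exact hM _ (pow_padicValNat_succ_smul_symm_mem_cycIntLattice_of_pairing m p Ψ hΨ φ Λ₀ hΛ₀ hpair z)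

/-! ### §5 (LAT_{c+v_p(m)}) with a general log-lattice exponent `c` (`p^c·𝒪_w ⊆ Λ₀ʷ`) -/

/-- **(LAT_{c+v_p(m)}) from per-factor duality data with `p^c·𝒪_w ⊆ Λ₀ʷ`** — the exponent `c` of the
per-factor input "`p^c·𝒪_w ⊆ log_ω(E₁(L_w))`" is `1` at ADDITIVE reduction (x1b's
`BallEval.exists_ptLog_eq_of_addv`, radius `1`) but the tree's reduction-free surjectivity
`BallEval.exists_ptLog_eq` has radius `1/4`, i.e. `c = 2` at `p = 3` (`‖y‖ ≤ 1/4 ⟺ y ∈ 9𝒪_w` for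
unramified `L_w`); since (C1ₑₓ) only asks for SOME `b`, this version (any `c`, any level `m`) lets every
tower row through with `b = c + v_p(m)` and NO new `p`-adic analysis.
[cite: Kim2022StructureSelmer, §3.4.1 and the proof of Thm. 3.13 (arXiv v3 pp. 26–27)]
[cite: BlochKato1990, Prop. 3.8] -/
theorem pow_add_padicValNat_smul_symm_mem_cycIntLattice_of_pairing (c : ℕ)
    [Fintype (((Rat.HeightOneSpectrum.primesEquiv (R := 𝓞 ℚ)).symm ⟨p, Fact.out⟩).Extension
      (𝓞 (CyclotomicField m ℚ)))]
    (Ψ : ℚ_[p] ⊗[ℚ] CyclotomicField m ℚ ≃ₐ[ℚ]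
      (Π w : ((Rat.HeightOneSpectrum.primesEquiv (R := 𝓞 ℚ)).symm ⟨p, Fact.out⟩).Extension
        (𝓞 (CyclotomicField m ℚ)), w.1.adicCompletion (CyclotomicField m ℚ)))
    (hΨ : ∀ (s : ℚ_[p]) (x : CyclotomicField m ℚ)
      (w : ((Rat.HeightOneSpectrum.primesEquiv (R := 𝓞 ℚ)).symm ⟨p, Fact.out⟩).Extension
        (𝓞 (CyclotomicField m ℚ))),
      Ψ (s ⊗ₜ[ℚ] x) w = algebraMap (CyclotomicField m ℚ) (w.1.adicCompletion (CyclotomicField m ℚ)) x *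
        algebraMap (((Rat.HeightOneSpectrum.primesEquiv (R := 𝓞 ℚ)).symm ⟨p, Fact.out⟩).adicCompletion ℚ)
          (w.1.adicCompletion (CyclotomicField m ℚ)) (Padic.adicCompletionEquiv (𝓞 ℚ) ⟨p, Fact.out⟩ s))
    {H : ((Rat.HeightOneSpectrum.primesEquiv (R := 𝓞 ℚ)).symm ⟨p, Fact.out⟩).Extension
        (𝓞 (CyclotomicField m ℚ)) → Type*}
    (φ : ∀ w, H w → w.1.adicCompletion (CyclotomicField m ℚ))
    (Λ₀ : ∀ w : ((Rat.HeightOneSpectrum.primesEquiv (R := 𝓞 ℚ)).symm ⟨p, Fact.out⟩).Extension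
        (𝓞 (CyclotomicField m ℚ)), Set (w.1.adicCompletion (CyclotomicField m ℚ)))
    (hΛ₀ : ∀ w, ∀ o ∈ w.1.adicCompletionIntegers (CyclotomicField m ℚ),
      (p : w.1.adicCompletion (CyclotomicField m ℚ)) ^ c * o ∈ Λ₀ w)
    (hpair : ∀ w (x : H w), ∀ l ∈ Λ₀ w,
      Algebra.trace (((Rat.HeightOneSpectrum.primesEquiv (R := 𝓞 ℚ)).symm ⟨p, Fact.out⟩).adicCompletion ℚ)
          (w.1.adicCompletion (CyclotomicField m ℚ)) (φ w x * l) ∈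
        (((Rat.HeightOneSpectrum.primesEquiv (R := 𝓞 ℚ)).symm ⟨p, Fact.out⟩).adicCompletionIntegers ℚ))
    (z : ∀ w, H w) :
    ((p ^ (c + padicValNat p m) : ℕ) : ℤ_[p]) • Ψ.symm (fun w => φ w (z w)) ∈ cycIntLattice p m := by
  have hsmul : ((p ^ c : ℕ) : ℤ_[p]) • Ψ.symm (fun w => φ w (z w)) =
      Ψ.symm (fun w => (p : w.1.adicCompletion (CyclotomicField m ℚ)) ^ c * φ w (z w)) := by
    rw [Nat.cast_smul_eq_nsmul, ← map_nsmul]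
    congr 1
    funext w
    rw [Pi.smul_apply, nsmul_eq_mul, Nat.cast_pow]
  rw [pow_add, Nat.cast_mul, mul_comm, mul_smul, hsmul]
  refine pow_padicValNat_smul_symm_mem_cycIntLattice_of_forall_trace_mul_mem m p Ψ hΨ _ fun w o ho => ?_
  rw [mul_comm ((p : w.1.adicCompletion (CyclotomicField m ℚ)) ^ c), mul_assoc]
  exact hpair w (z w) _ (hΛ₀ w o ho)

/-- **(LAT_b), `b = c + v_p(m)`, in acc5's `Σ_w ι_w` binder shape** for ANY target `ℤ_p`-submodule `M`
containing every `μ` with `p^{c+v_p(m)}·μ ∈ cycIntLattice p m`.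
[cite: Kim2022StructureSelmer, §3.4.1 and the proof of Thm. 3.13 (arXiv v3 pp. 26–27)] -/
theorem sum_symm_single_mem_of_pairing_pow (c : ℕ)
    [Fintype (((Rat.HeightOneSpectrum.primesEquiv (R := 𝓞 ℚ)).symm ⟨p, Fact.out⟩).Extension
      (𝓞 (CyclotomicField m ℚ)))]
    [DecidableEq (((Rat.HeightOneSpectrum.primesEquiv (R := 𝓞 ℚ)).symm ⟨p, Fact.out⟩).Extension
      (𝓞 (CyclotomicField m ℚ)))]
    (Ψ : ℚ_[p] ⊗[ℚ] CyclotomicField m ℚ ≃ₐ[ℚ]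
      (Π w : ((Rat.HeightOneSpectrum.primesEquiv (R := 𝓞 ℚ)).symm ⟨p, Fact.out⟩).Extension
        (𝓞 (CyclotomicField m ℚ)), w.1.adicCompletion (CyclotomicField m ℚ)))
    (hΨ : ∀ (s : ℚ_[p]) (x : CyclotomicField m ℚ)
      (w : ((Rat.HeightOneSpectrum.primesEquiv (R := 𝓞 ℚ)).symm ⟨p, Fact.out⟩).Extension
        (𝓞 (CyclotomicField m ℚ))),
      Ψ (s ⊗ₜ[ℚ] x) w = algebraMap (CyclotomicField m ℚ) (w.1.adicCompletion (CyclotomicField m ℚ)) x *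
        algebraMap (((Rat.HeightOneSpectrum.primesEquiv (R := 𝓞 ℚ)).symm ⟨p, Fact.out⟩).adicCompletion ℚ)
          (w.1.adicCompletion (CyclotomicField m ℚ)) (Padic.adicCompletionEquiv (𝓞 ℚ) ⟨p, Fact.out⟩ s))
    (M : Submodule ℤ_[p] (ℚ_[p] ⊗[ℚ] CyclotomicField m ℚ))
    (hM : ∀ μ : ℚ_[p] ⊗[ℚ] CyclotomicField m ℚ,
      ((p ^ (c + padicValNat p m) : ℕ) : ℤ_[p]) • μ ∈ cycIntLattice p m → μ ∈ M)
    {H : ((Rat.HeightOneSpectrum.primesEquiv (R := 𝓞 ℚ)).symm ⟨p, Fact.out⟩).Extension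
        (𝓞 (CyclotomicField m ℚ)) → Type*}
    (φ : ∀ w, H w → w.1.adicCompletion (CyclotomicField m ℚ))
    (Λ₀ : ∀ w : ((Rat.HeightOneSpectrum.primesEquiv (R := 𝓞 ℚ)).symm ⟨p, Fact.out⟩).Extension
        (𝓞 (CyclotomicField m ℚ)), Set (w.1.adicCompletion (CyclotomicField m ℚ)))
    (hΛ₀ : ∀ w, ∀ o ∈ w.1.adicCompletionIntegers (CyclotomicField m ℚ),
      (p : w.1.adicCompletion (CyclotomicField m ℚ)) ^ c * o ∈ Λ₀ w)
    (hpair : ∀ w (x : H w), ∀ l ∈ Λ₀ w,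
      Algebra.trace (((Rat.HeightOneSpectrum.primesEquiv (R := 𝓞 ℚ)).symm ⟨p, Fact.out⟩).adicCompletion ℚ)
          (w.1.adicCompletion (CyclotomicField m ℚ)) (φ w x * l) ∈
        (((Rat.HeightOneSpectrum.primesEquiv (R := 𝓞 ℚ)).symm ⟨p, Fact.out⟩).adicCompletionIntegers ℚ))
    (z : ∀ w, H w) :
    ∑ w, Ψ.symm (Pi.single w (φ w (z w))) ∈ M := by
  rw [sum_symm_single_eq m p Ψ]
  exact hM _ (pow_add_padicValNat_smul_symm_mem_cycIntLattice_of_pairing m p c Ψ hΨ φ Λ₀ hΛ₀ hpair z)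

end Summit.BirchSwinnertonDyer.BirchSwinnertonDyer.Theorems.KimAtThreeSemiLocalTraceDualLevel

end
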